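import Summits.ResolutionOfSingularities.KangarooAtlas.MizutaniShiftedPoint
import Summits.ResolutionOfSingularities.KangarooAtlas.MizutaniLemma24Tower
import Summits.ResolutionOfSingularities.KangarooAtlas.MizutaniRationalField
import HarnessLib

/-!
# Mizutani's Lemma 2.7 in full for fields with a finite `p`-basis

Cell `pub-rosobs`, Mizutani enclosure (seat mizutani-encloser-2, gen 9).  AI-written; *AI review is weaker than expert review*;
NOT a resolution-of-singularities theorem (summit relevance C).

Mizutani 1973, Lemma 2.7: «Let `H = H(N_e, W_e)` be an H-scheme with `e(H) ≤ e`, and let `e' ≤ e`.  Then `F^{e−e'}(H)` is an H-scheme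
`H'` with `e(H') ≤ e'` and `dim H = dim H'`.»  In the tree's dictionary an H-scheme is the Hironaka scheme `B_{P,𝔭} = Spec S/U_+(𝔭)S`
of a point `𝔭` of `ℙ^n_k` (`bIdeal`), its Frobenius image `F^m(B_{P,𝔭})` is `V(famIdeal (j ↦ (U(𝔭)∩L)_{j+m}))`
(`MizutaniExpandShift`, and `= (bIdeal k 𝔭).comap (expand p^m)` by `MizutaniFrobeniusImage.comap_expand_bIdeal`), and
`MizutaniShiftedPoint.exists_point_bIdeal_eq_famIdeal_shift_of_lemma24` proved the lemma GRANTED Mizutani's Lemma 2.4 in the dual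
pair form of `MizutaniLevelComparison`.  Encloser-1's `MizutaniLemma24Tower.lemma24_pair_of_isRootTower` proves that pair form for
every field `k` which is a root tower over `k^{p^{j+1}}` and over `k^{p^j}` with the same generators.  This file supplies those towers
from a FINITE `p`-BASIS `b : Fin s → k` of `k` — `PIndep p 1 b` (the monomials `b^W`, `W ∈ [0,p−1]^s`, are `k^p`-independent) and
`k = k^p(b)` — and assembles LEMMA 2.7 IN FULL, unconditionally, for every such `k` (e.g. `k = 𝔽_p(u_1, …, u_s)`,
`MizutaniRationalField`; every field of finite `p`-degree `[k : k^p] = p^s` has such a `b`):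

* `pIndep_zero`, `adjoin_frobPow_eq_top_of_one` (`k = k^p(b) ⇒ k = k^{p^j}(b)` for every `j`), `isRootTower_of_pBasis`
  (`k` is a root tower of order `p^j` over `k^{p^j}` with generators `b`, every `j`);
* `lemma24_pair_of_pBasis` — Lemma 2.4 (dual pair form) at every level; `jCore_dSpan_le_succ_of_pBasis`,
  `jCore_dSpan_le_of_le_of_pBasis` (`𝒥_{e'}𝒟_{e'}(V) ≤ 𝒥_e𝒟_e(V)` for `e' ≤ e`), `jCore_dSpan_invForms_eq_of_le_of_pBasis`
  (`𝒥_{e'}𝒟_{e'}((L_B)_e(𝔭)) = (L_B)_e(𝔭)` for every point and every `e' ≤ e` — Mizutani's «`𝒥_{e'}𝒟_{e'}(V) ⊂ 𝒥_e𝒟_e(V) = V`»);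
* **`exists_point_bIdeal_eq_famIdeal_shift_of_pBasis`** — LEMMA 2.7: for a point `𝔭` with `exponent B(𝔭) ≤ e` and `m ≤ e`, the Frobenius
  image `F^m(B_{P,𝔭})` is the Hironaka scheme `B_{P,𝔭'}` of a point `𝔭'` with `(L_B)_j(𝔭') = (L_B)_{j+m}(𝔭)` for all `j`, exponent `≤ e − m` and
  `dim B(𝔭') = dim B(𝔭)`; **`exists_isPoint_invForms_eq_sub_of_pBasis`** — the point half in encloser-1's phrasing, `m` Frobenius steps at once;
  `exists_isPrime_point_bIdeal_eq_famIdeal_shift_of_pBasis` — the right-hand side of `exists_point_bIdeal_eq_famIdeal_shift_iff_jCore_dSpan_eq`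
  discharged.
* `exists_pBasis_of_finiteDimensional` (`[k : k^p] < ∞ ⇒` a finite `p`-basis exists) and the same statements for EVERY FIELD OF FINITE `p`-DEGREE
  (`[FiniteDimensional (frobPow k p 1) k]`): `lemma24_pair_of_finite_pDegree`, `jCore_dSpan_le_of_le`, `jCore_dSpan_invForms_eq_of_le`,
  **`exists_point_bIdeal_eq_famIdeal_shift`** (LEMMA 2.7), `exists_isPoint_invForms_eq_sub`, `exists_isPoint_invForms_eq_iff_forall_le`.
* every shift `m` with the exact exponent `exponent B(𝔭') = exponent B(𝔭) − m`: `exists_point_bIdeal_eq_famIdeal_shift_exponent(_of_pBasis)`;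
  `finiteDimensional_frobPow_one_ratField` (`𝔽_p(u_1, …, u_s)` has finite `p`-degree).

NOT covered: `k` of infinite `p`-degree (the operators `D^{(M)}` of a finite envelope do not extend to `k` without a `p`-basis — encloser-1's
seat HANDOFF); the `comap (expand p^m)` phrasing (one rewrite by `comap_expand_bIdeal`, not co-importable with `MizutaniHSchemeCriterion` until the
duplicate `linForm_mem_span_linForm_iff` of `MizutaniExpandTransport` is removed, work item wi-83304).

References: H. Mizutani, Nagoya Math. J. 52 (1973) 85–95, Lemma 2.4, Lemma 2.7 [Mizutani1973HironakaGroupSchemes]; T. Oda, Publ. RIMS 19 (1983),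
§1 [Oda1983HironakaGroupSchemeII].
-/

noncomputable section

open MvPolynomial Literature.AlgebraicGeometry.Resolution Literature.AlgebraicGeometry.Resolution.HironakaScheme

namespace Summit.ResolutionOfSingularities.KangarooAtlas.Mizutani

universe u

section PBasisTowers

variable {k : Type u} [Field k] {p : ℕ} [hp : Fact p.Prime] [CharP k p] {s : ℕ} {b : Fin s → k}

variable (p b) in
/-- Level `0`: the single box monomial `b^0 = 1` is `k`-independent. [folklore] -/
theorem pIndep_zero : PIndep p 0 b := by
  have hW : ∀ W : Fin s → Fin (p ^ 0), fmon b W = 1 := fun W => by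
    unfold fmon
    refine Finset.prod_eq_one fun i _ => ?_
    have hi : ((W i : Fin (p ^ 0)) : ℕ) = 0 := by have := (W i).2.trans_eq (pow_zero p); omega
    rw [hi, pow_zero]
  haveI : Subsingleton (Fin s → Fin (p ^ 0)) :=
    ⟨fun W W' => funext fun i => Fin.ext (by
      have h₁ := (W i).2.trans_eq (pow_zero p); have h₂ := (W' i).2.trans_eq (pow_zero p); omega)⟩
  refine Fintype.linearIndependent_iff.mpr fun g hg W => ?_
  rw [Fintype.sum_subsingleton _ W, hW, Subfield.smul_def, smul_eq_mul, mul_one] at hg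
  exact_mod_cast hg

/-- **`k = k^p(b)` implies `k = k^{p^j}(b)` for every `j`** (`k^p = k^{p²}(b^p)`, so `k = k^{p²}(b, b^p) = k^{p²}(b)`, and so on).
[cite: Mizutani1973HironakaGroupSchemes, Lemma 2.4 (p. 88: K = k^q(c_1, …, c_m) for a p-basis)] -/
theorem adjoin_frobPow_eq_top_of_one (htop : IntermediateField.adjoin (frobPow k p 1) (Set.range b) = ⊤) :
    ∀ j : ℕ, IntermediateField.adjoin (frobPow k p j) (Set.range b) = ⊤
  | 0 => eq_top_iff.mpr fun y _ => IntermediateField.algebraMap_mem _ (⟨y, mem_frobPow_zero y⟩ : frobPow k p 0)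
  | j + 1 => by
    have ih := adjoin_frobPow_eq_top_of_one htop j
    have key : ∀ y, y ∈ IntermediateField.adjoin (frobPow k p 1) (Set.range b) →
        y ∈ IntermediateField.adjoin (frobPow k p (j + 1)) (Set.range b) := by
      intro y hy
      induction hy using IntermediateField.adjoin_induction with
      | mem x hx => exact IntermediateField.subset_adjoin _ _ hx
      | algebraMap κ =>
        obtain ⟨w, hw⟩ := mem_frobPow_iff.mp κ.2
        have hwj : w ∈ IntermediateField.adjoin (frobPow k p j) (Set.range b) := by rw [ih]; trivial
        have := pow_mem_adjoin b j 1 hwj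
        rw [Nat.add_comm 1 j, hw] at this
        exact this
      | add x y _ _ hx hy => exact add_mem hx hy
      | inv x _ hx => exact inv_mem hx
      | mul x y _ _ hx hy => exact mul_mem hx hy
    exact eq_top_iff.mpr fun y _ => key y (by rw [htop]; trivial)

/-- **A field with a finite `p`-basis `b` is a root tower of order `p^j` over `k^{p^j}` with generators `b`, for every `j`**:
`k^{p^j}[Y]/(Y_i^{p^j} − b_i^{p^j}) ≅ k` (encloser-2's `isRootTower_adjoin` for the `k^{p^j}`-independent box monomials of `b`, transported along
`k^{p^j}(b) = ⊤ ≃ k`). [cite: Mizutani1973HironakaGroupSchemes, Remark 2.10 and Lemma 2.4 (in-house note §1.1: towers)] -/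
theorem isRootTower_of_pBasis (hb : PIndep p 1 b) (htop : IntermediateField.adjoin (frobPow k p 1) (Set.range b) = ⊤) (j : ℕ) :
    IsRootTower (frobPow k p j) k (p ^ j) (towerPow j b) b := by
  have hbj : PIndep p j b := by
    rcases Nat.eq_zero_or_pos j with rfl | hj
    · exact pIndep_zero p b
    · exact hb.of_one j hj
  have h := isRootTower_adjoin hbj
  set φ : towerField j b ≃ₐ[frobPow k p j] k :=
    (IntermediateField.equivOfEq (adjoin_frobPow_eq_top_of_one htop j)).trans IntermediateField.topEquiv with hφ
  have hcomp : (φ ∘ towerGen j b) = b := by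
    funext i
    rw [Function.comp_apply, hφ, AlgEquiv.trans_apply, IntermediateField.topEquiv_apply, IntermediateField.equivOfEq_apply,
      coe_towerGen]
  rw [← hcomp]
  exact h.of_algEquiv φ

/-- `[k : k^{p^j}] = (p^j)^s` for a field with a finite `p`-basis of `s` elements. [cite: Mizutani1973HironakaGroupSchemes, Lemma 2.4 (p. 88)] -/
theorem finrank_frobPow_of_pBasis (hb : PIndep p 1 b) (htop : IntermediateField.adjoin (frobPow k p 1) (Set.range b) = ⊤) {j : ℕ}
    (hj : 1 ≤ j) : Module.finrank (frobPow k p j) k = (p ^ j) ^ s := by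
  set φ : towerField j b ≃ₐ[frobPow k p j] k :=
    (IntermediateField.equivOfEq (adjoin_frobPow_eq_top_of_one htop j)).trans IntermediateField.topEquiv with hφ
  rw [← φ.toLinearEquiv.finrank_eq, finrank_adjoin_eq (hb.of_one j hj)]

end PBasisTowers

section Lemma27

variable (k : Type u) [Field k] (p : ℕ) [hp : Fact p.Prime] [CharP k p] {n s : ℕ} {b : Fin s → k}

/-- **MIZUTANI'S LEMMA 2.4 (dual pair form) at every level, for a field with a finite `p`-basis**: if `Σ_i D'(a_i)·D₀(c_i) = 0` for all
`D' ∈ Diff_{p^j−1}(k/k^{p^j})` and all `D₀ ∈ Diff_{p^{j+1}−p^j}(k/k^{p^{j+1}})`, then `Σ a_i ⊗ c_i ∈ J_{j+1}^{p^{j+1}}` — encloser-1's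
`lemma24_pair_of_isRootTower` with the towers `isRootTower_of_pBasis`. AI-written; *AI review is weaker than expert review*.
[cite: Mizutani1973HironakaGroupSchemes, Lemma 2.4] -/
theorem lemma24_pair_of_pBasis (hb : PIndep p 1 b) (htop : IntermediateField.adjoin (frobPow k p 1) (Set.range b) = ⊤) (j : ℕ)
    (a c : Fin (n + 1) → k)
    (hac : ∀ (D' : k →ₗ[frobPow k p j] k) (D₀ : k →ₗ[frobPow k p (j + 1)] k), IsDiffOpLE (frobPow k p j) (p ^ j - 1) D' →
      IsDiffOpLE (frobPow k p (j + 1)) (p ^ (j + 1) - p ^ j) D₀ → ∑ i, D' (a i) * D₀ (c i) = 0) :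
    tens k p (j + 1) a c ∈ KaehlerDifferential.ideal (frobPow k p (j + 1)) k ^ p ^ (j + 1) :=
  lemma24_pair_of_isRootTower k p j (isRootTower_of_pBasis hb htop (j + 1)) (isRootTower_of_pBasis hb htop j) a c hac

/-- **`𝒥_j𝒟_j(V) ≤ 𝒥_{j+1}𝒟_{j+1}(V)`** for every subspace `V ⊆ k^{n+1}`, `k` with a finite `p`-basis.
[cite: Mizutani1973HironakaGroupSchemes, Lemma 2.7 (proof: 𝒥_{e'}𝒟_{e'}(V) ⊂ 𝒥_e𝒟_e(V))] -/
theorem jCore_dSpan_le_succ_of_pBasis (hb : PIndep p 1 b) (htop : IntermediateField.adjoin (frobPow k p 1) (Set.range b) = ⊤)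
    (j : ℕ) (V : Submodule k (Fin (n + 1) → k)) :
    jCore k p j (dSpan k p j V) ≤ jCore k p (j + 1) (dSpan k p (j + 1) V) :=
  jCore_dSpan_le_succ_of_isRootTower k p j (isRootTower_of_pBasis hb htop (j + 1)) (isRootTower_of_pBasis hb htop j) V

/-- **`𝒥_{e'}𝒟_{e'}(V) ≤ 𝒥_e𝒟_e(V)` for `e' ≤ e`**, `k` with a finite `p`-basis. [cite: Mizutani1973HironakaGroupSchemes, Lemma 2.7 (proof)] -/
theorem jCore_dSpan_le_of_le_of_pBasis (hb : PIndep p 1 b) (htop : IntermediateField.adjoin (frobPow k p 1) (Set.range b) = ⊤)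
    {e e' : ℕ} (he : e' ≤ e) (V : Submodule k (Fin (n + 1) → k)) :
    jCore k p e' (dSpan k p e' V) ≤ jCore k p e (dSpan k p e V) := by
  obtain ⟨i, rfl⟩ := Nat.exists_eq_add_of_le he
  exact jCore_dSpan_le_add_of_mono k p (fun j => jCore_dSpan_le_succ_of_pBasis k p hb htop j V) e' i

/-- **`𝒥_{e'}𝒟_{e'}((L_B)_e(𝔭)) = (L_B)_e(𝔭)` for EVERY point `𝔭` of `ℙ^n_k` and every `e' ≤ e`**, `k` with a finite `p`-basis — the closedness
condition of `exists_point_bIdeal_eq_famIdeal_shift_iff_jCore_dSpan_eq`, discharged (`V ≤ 𝒥_{e'}𝒟_{e'}V ≤ 𝒥_e𝒟_eV = V`).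
[cite: Mizutani1973HironakaGroupSchemes, Lemma 2.7 (proof) with Lemma 2.4] -/
theorem jCore_dSpan_invForms_eq_of_le_of_pBasis (hb : PIndep p 1 b) (htop : IntermediateField.adjoin (frobPow k p 1) (Set.range b) = ⊤)
    (𝔭 : Ideal (MvPolynomial (Fin (n + 1)) k)) {e e' : ℕ} (he : e' ≤ e) :
    jCore k p e' (dSpan k p e' (invForms k p 𝔭 e)) = invForms k p 𝔭 e :=
  jCore_dSpan_eq_of_le_of_mono k p (fun j => jCore_dSpan_le_succ_of_pBasis k p hb htop j _) he (jCore_dSpan_invForms k p 𝔭 e)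

/-- **MIZUTANI'S LEMMA 2.7 IN FULL, for a field `k` with a finite `p`-basis.**  Let `𝔭` be a point of `ℙ^n_k` with `exponent B(𝔭) ≤ e` and let
`m ≤ e`.  Then the Frobenius image `F^m(B_{P,𝔭})` — the scheme `V(famIdeal (j ↦ (U(𝔭)∩L)_{j+m}))` of the shifted invariant forms
(`= V((bIdeal k 𝔭).comap (expand p^m))`, `MizutaniFrobeniusImage.comap_expand_bIdeal`) — IS the Hironaka scheme `B_{P,𝔭'}` of a point `𝔭'` of
`ℙ^n_k`, with `(L_B)_j(𝔭') = (L_B)_{j+m}(𝔭)` for every `j` (same «type» at level `e − m`), `exponent B(𝔭') ≤ e − m`, and `dim B(𝔭') = dim B(𝔭)`.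
Composition of `exists_point_bIdeal_eq_famIdeal_shift_of_lemma24` (encloser-2) with `lemma24_pair_of_isRootTower` (encloser-1) and the towers
`isRootTower_of_pBasis`.  AI-written; *AI review is weaker than expert review*; not a resolution theorem.
[cite: Mizutani1973HironakaGroupSchemes, Lemma 2.7 (p. 89–90)] -/
theorem exists_point_bIdeal_eq_famIdeal_shift_of_pBasis (hb : PIndep p 1 b)
    (htop : IntermediateField.adjoin (frobPow k p 1) (Set.range b) = ⊤) (𝔭 : Ideal (MvPolynomial (Fin (n + 1)) k)) [𝔭.IsPrime]
    (hP : IsPoint k 𝔭) {e m : ℕ} (hm : m ≤ e) (hE : ExponentLE k p 𝔭 e) :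
    ∃ 𝔭' : Ideal (MvPolynomial (Fin (n + 1)) k), IsPoint k 𝔭' ∧
      bIdeal k 𝔭' = famIdeal k p (fun j => hirForms k p 𝔭 (j + m)) ∧
      (∀ j, invForms k p 𝔭' j = invForms k p 𝔭 (j + m)) ∧ ExponentLE k p 𝔭' (e - m) ∧
      hsDim k p 𝔭' = hsDim k p 𝔭 :=
  exists_point_bIdeal_eq_famIdeal_shift_of_lemma24 k p 𝔭 (fun j a c hac => lemma24_pair_of_pBasis k p hb htop j a c hac) hP hm hE

/-- **The existence side of `exists_point_bIdeal_eq_famIdeal_shift_iff_jCore_dSpan_eq`, discharged** for `k` with a finite `p`-basis: the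
scheme of the shifted forms of a point of exponent `≤ e` is the Hironaka scheme of some (prime) point, for every shift `m ≤ e`.
[cite: Mizutani1973HironakaGroupSchemes, Lemma 2.7] -/
theorem exists_isPrime_point_bIdeal_eq_famIdeal_shift_of_pBasis (hb : PIndep p 1 b)
    (htop : IntermediateField.adjoin (frobPow k p 1) (Set.range b) = ⊤) (𝔭 : Ideal (MvPolynomial (Fin (n + 1)) k)) [𝔭.IsPrime]
    (hP : IsPoint k 𝔭) {e m : ℕ} (hm : m ≤ e) (hE : ExponentLE k p 𝔭 e) :
    ∃ 𝔭' : Ideal (MvPolynomial (Fin (n + 1)) k), 𝔭'.IsPrime ∧ IsPoint k 𝔭' ∧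
      bIdeal k 𝔭' = famIdeal k p (fun j => hirForms k p 𝔭 (j + m)) :=
  (exists_point_bIdeal_eq_famIdeal_shift_iff_jCore_dSpan_eq k p 𝔭 hP hm hE).mpr
    (jCore_dSpan_invForms_eq_of_le_of_pBasis k p hb htop 𝔭 (Nat.sub_le e m))

/-- **THE POINT HALF OF LEMMA 2.7, `m` Frobenius steps at once, for `k` with a finite `p`-basis**: if `V` is `(L_B)_e(𝔭)` of a point `𝔭` of
`ℙ^n_k` with exponent `≤ e` and `m ≤ e`, then `V` is `(L_B)_{e−m}(𝔮)` of a point `𝔮` with exponent `≤ e − m` (iterate of encloser-1's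
`exists_isPoint_invForms_eq_pred_of_isRootTower`). [cite: Mizutani1973HironakaGroupSchemes, Lemma 2.7 with Thm. 1.3 (iii)] -/
theorem exists_isPoint_invForms_eq_sub_of_pBasis (hb : PIndep p 1 b)
    (htop : IntermediateField.adjoin (frobPow k p 1) (Set.range b) = ⊤) {e m : ℕ} (hm : m ≤ e) {V : Submodule k (Fin (n + 1) → k)}
    (hV : ∃ 𝔭 : Ideal (MvPolynomial (Fin (n + 1)) k), IsPoint k 𝔭 ∧ ExponentLE k p 𝔭 e ∧ invForms k p 𝔭 e = V) :
    ∃ 𝔮 : Ideal (MvPolynomial (Fin (n + 1)) k), IsPoint k 𝔮 ∧ ExponentLE k p 𝔮 (e - m) ∧ invForms k p 𝔮 (e - m) = V := by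
  obtain ⟨𝔭, hP, hE, rfl⟩ := hV
  haveI := hP.1
  obtain ⟨𝔮, hQ, -, hinv, hE', -⟩ := exists_point_bIdeal_eq_famIdeal_shift_of_pBasis k p hb htop 𝔭 hP hm hE
  exact ⟨𝔮, hQ, hE', by rw [hinv, Nat.sub_add_cancel hm]⟩

/-- **Which subspaces are `(L_B)_e` of a point of exponent `≤ e`, for `k` with a finite `p`-basis** (Theorem 1.3 (iii) with Lemma 2.7): `V` is
`(L_B)_e(𝔭)` for a point `𝔭` with `exponent ≤ e` iff `V ≠ k^{n+1}` and `𝒥_{e'}𝒟_{e'}(V) = V` for EVERY `e' ≤ e` (Theorem 1.3 (iii) asks this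
at `e' = e` only; the other levels follow by Lemma 2.4). [cite: Mizutani1973HironakaGroupSchemes, Thm. 1.3 (iii) and Lemma 2.7] -/
theorem exists_isPoint_invForms_eq_iff_forall_le_of_pBasis (hb : PIndep p 1 b)
    (htop : IntermediateField.adjoin (frobPow k p 1) (Set.range b) = ⊤) (e : ℕ) (V : Submodule k (Fin (n + 1) → k)) :
    (∃ 𝔭 : Ideal (MvPolynomial (Fin (n + 1)) k), IsPoint k 𝔭 ∧ ExponentLE k p 𝔭 e ∧ invForms k p 𝔭 e = V) ↔
      V ≠ ⊤ ∧ ∀ e', e' ≤ e → jCore k p e' (dSpan k p e' V) = V := by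
  rw [exists_isPoint_invForms_eq_iff k p e]
  refine ⟨fun ⟨hne, hV⟩ => ⟨hne, fun e' he' => ?_⟩, fun ⟨hne, hV⟩ => ⟨hne, hV e le_rfl⟩⟩
  exact jCore_dSpan_eq_of_le_of_mono k p (fun j => jCore_dSpan_le_succ_of_pBasis k p hb htop j V) he' hV

end Lemma27

/-! ### Every field of finite `p`-degree `[k : k^p] < ∞` -/

section FinitePDegree

variable (k : Type u) [Field k] (p : ℕ) [hp : Fact p.Prime] [CharP k p] {n : ℕ}

/-- **A field of finite `p`-degree has a finite `p`-basis**: if `[k : k^p] < ∞` there is a `p`-independent `b : Fin s → k` with `k = k^p(b)`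
(the greedy `p`-independent envelope `exists_pIndep_adjoin` of a `k^p`-basis of `k`).
[cite: Mizutani1973HironakaGroupSchemes, Lemma 2.4 (p. 88: a p-basis Λ of k over k^p)] -/
theorem exists_pBasis_of_finiteDimensional [FiniteDimensional (frobPow k p 1) k] :
    ∃ (s : ℕ) (b : Fin s → k), PIndep p 1 b ∧ IntermediateField.adjoin (frobPow k p 1) (Set.range b) = ⊤ := by
  classical
  set B := Module.finBasis (frobPow k p 1) k with hB
  obtain ⟨s, b, hb, hY⟩ := exists_pIndep_adjoin (p := p) 1 (Finset.univ.image B)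
  refine ⟨s, b, hb, eq_top_iff.mpr fun y _ => ?_⟩
  have hy : y ∈ Submodule.span (frobPow k p 1) (Set.range B) := by rw [B.span_eq]; trivial
  have hle : Submodule.span (frobPow k p 1) (Set.range B) ≤
      Subalgebra.toSubmodule (IntermediateField.adjoin (frobPow k p 1) (Set.range b)).toSubalgebra := by
    refine Submodule.span_le.mpr ?_
    rintro _ ⟨i, rfl⟩
    exact hY (Finset.mem_coe.mpr (Finset.mem_image_of_mem B (Finset.mem_univ i)))
  exact hle hy

/-- **LEMMA 2.4 (dual pair form) at every level for every field of finite `p`-degree.** AI-written; *AI review is weaker than expert review*.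
[cite: Mizutani1973HironakaGroupSchemes, Lemma 2.4] -/
theorem lemma24_pair_of_finite_pDegree [FiniteDimensional (frobPow k p 1) k] (j : ℕ) (a c : Fin (n + 1) → k)
    (hac : ∀ (D' : k →ₗ[frobPow k p j] k) (D₀ : k →ₗ[frobPow k p (j + 1)] k), IsDiffOpLE (frobPow k p j) (p ^ j - 1) D' →
      IsDiffOpLE (frobPow k p (j + 1)) (p ^ (j + 1) - p ^ j) D₀ → ∑ i, D' (a i) * D₀ (c i) = 0) :
    tens k p (j + 1) a c ∈ KaehlerDifferential.ideal (frobPow k p (j + 1)) k ^ p ^ (j + 1) := by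
  obtain ⟨_, _, hb, htop⟩ := exists_pBasis_of_finiteDimensional k p
  exact lemma24_pair_of_pBasis k p hb htop j a c hac

/-- **`𝒥_{e'}𝒟_{e'}(V) ≤ 𝒥_e𝒟_e(V)` for `e' ≤ e`**, every field of finite `p`-degree. [cite: Mizutani1973HironakaGroupSchemes, Lemma 2.7 (proof)] -/
theorem jCore_dSpan_le_of_le [FiniteDimensional (frobPow k p 1) k] {e e' : ℕ} (he : e' ≤ e) (V : Submodule k (Fin (n + 1) → k)) :
    jCore k p e' (dSpan k p e' V) ≤ jCore k p e (dSpan k p e V) := by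
  obtain ⟨_, _, hb, htop⟩ := exists_pBasis_of_finiteDimensional k p
  exact jCore_dSpan_le_of_le_of_pBasis k p hb htop he V

/-- **`𝒥_{e'}𝒟_{e'}((L_B)_e(𝔭)) = (L_B)_e(𝔭)` for every point and every `e' ≤ e`**, every field of finite `p`-degree.
[cite: Mizutani1973HironakaGroupSchemes, Lemma 2.7 (proof) with Lemma 2.4] -/
theorem jCore_dSpan_invForms_eq_of_le [FiniteDimensional (frobPow k p 1) k] (𝔭 : Ideal (MvPolynomial (Fin (n + 1)) k))
    {e e' : ℕ} (he : e' ≤ e) : jCore k p e' (dSpan k p e' (invForms k p 𝔭 e)) = invForms k p 𝔭 e := by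
  obtain ⟨_, _, hb, htop⟩ := exists_pBasis_of_finiteDimensional k p
  exact jCore_dSpan_invForms_eq_of_le_of_pBasis k p hb htop 𝔭 he

/-- **MIZUTANI'S LEMMA 2.7 IN FULL FOR EVERY FIELD OF FINITE `p`-DEGREE `[k : k^p] < ∞`.**  For a point `𝔭` of `ℙ^n_k` with
`exponent B(𝔭) ≤ e` and `m ≤ e`, the Frobenius image `F^m(B_{P,𝔭}) = V(famIdeal (j ↦ (U(𝔭)∩L)_{j+m}))` is the Hironaka scheme `B_{P,𝔭'}` of a
point `𝔭'` of `ℙ^n_k` with `(L_B)_j(𝔭') = (L_B)_{j+m}(𝔭)` for all `j`, `exponent B(𝔭') ≤ e − m`, `dim B(𝔭') = dim B(𝔭)`.  AI-written; *AI review is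
weaker than expert review*; not a resolution theorem. [cite: Mizutani1973HironakaGroupSchemes, Lemma 2.7 (p. 89–90)] -/
theorem exists_point_bIdeal_eq_famIdeal_shift [FiniteDimensional (frobPow k p 1) k] (𝔭 : Ideal (MvPolynomial (Fin (n + 1)) k))
    [𝔭.IsPrime] (hP : IsPoint k 𝔭) {e m : ℕ} (hm : m ≤ e) (hE : ExponentLE k p 𝔭 e) :
    ∃ 𝔭' : Ideal (MvPolynomial (Fin (n + 1)) k), IsPoint k 𝔭' ∧
      bIdeal k 𝔭' = famIdeal k p (fun j => hirForms k p 𝔭 (j + m)) ∧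
      (∀ j, invForms k p 𝔭' j = invForms k p 𝔭 (j + m)) ∧ ExponentLE k p 𝔭' (e - m) ∧
      hsDim k p 𝔭' = hsDim k p 𝔭 := by
  obtain ⟨_, _, hb, htop⟩ := exists_pBasis_of_finiteDimensional k p
  exact exists_point_bIdeal_eq_famIdeal_shift_of_pBasis k p hb htop 𝔭 hP hm hE

/-- **The point half of Lemma 2.7, `m` steps, for every field of finite `p`-degree**: `(L_B)_e` of a point of exponent `≤ e` is `(L_B)_{e−m}` of a
point of exponent `≤ e − m`. [cite: Mizutani1973HironakaGroupSchemes, Lemma 2.7 with Thm. 1.3 (iii)] -/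
theorem exists_isPoint_invForms_eq_sub [FiniteDimensional (frobPow k p 1) k] {e m : ℕ} (hm : m ≤ e)
    {V : Submodule k (Fin (n + 1) → k)}
    (hV : ∃ 𝔭 : Ideal (MvPolynomial (Fin (n + 1)) k), IsPoint k 𝔭 ∧ ExponentLE k p 𝔭 e ∧ invForms k p 𝔭 e = V) :
    ∃ 𝔮 : Ideal (MvPolynomial (Fin (n + 1)) k), IsPoint k 𝔮 ∧ ExponentLE k p 𝔮 (e - m) ∧ invForms k p 𝔮 (e - m) = V := by
  obtain ⟨_, _, hb, htop⟩ := exists_pBasis_of_finiteDimensional k p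
  exact exists_isPoint_invForms_eq_sub_of_pBasis k p hb htop hm hV

/-- **Which subspaces are `(L_B)_e` of a point of exponent `≤ e`, every field of finite `p`-degree**: iff `V ≠ k^{n+1}` and `𝒥_{e'}𝒟_{e'}(V) = V`
for every `e' ≤ e`. [cite: Mizutani1973HironakaGroupSchemes, Thm. 1.3 (iii) and Lemma 2.7] -/
theorem exists_isPoint_invForms_eq_iff_forall_le [FiniteDimensional (frobPow k p 1) k] (e : ℕ) (V : Submodule k (Fin (n + 1) → k)) :
    (∃ 𝔭 : Ideal (MvPolynomial (Fin (n + 1)) k), IsPoint k 𝔭 ∧ ExponentLE k p 𝔭 e ∧ invForms k p 𝔭 e = V) ↔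
      V ≠ ⊤ ∧ ∀ e', e' ≤ e → jCore k p e' (dSpan k p e' V) = V := by
  obtain ⟨_, _, hb, htop⟩ := exists_pBasis_of_finiteDimensional k p
  exact exists_isPoint_invForms_eq_iff_forall_le_of_pBasis k p hb htop e V

end FinitePDegree

/-! ### Every shift `m`, with the exact exponent `e(F^m B) = e(B) − m`; the rational function field -/

section Exponent

variable (k : Type u) [Field k] (p : ℕ) [hp : Fact p.Prime] [CharP k p] {n s : ℕ} {b : Fin s → k}

/-- **LEMMA 2.7 FOR EVERY SHIFT `m`, WITH THE EXACT EXPONENT**, `k` with a finite `p`-basis: for every point `𝔭` of `ℙ^n_k` and every `m`, the Frobenius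
image `F^m(B_{P,𝔭})` is the Hironaka scheme `B_{P,𝔭'}` of a point `𝔭'` with `(L_B)_j(𝔭') = (L_B)_{j+m}(𝔭)` for all `j`, **`exponent B(𝔭') = exponent B(𝔭) − m`**
(truncated) and `dim B(𝔭') = dim B(𝔭)` (apply the lemma at `e = max m (exponent B(𝔭))`; `exponent_eq_sub_of_invForms_shift`).
[cite: Mizutani1973HironakaGroupSchemes, Lemma 2.7 and Remark 2.10 (m(1) ≤ m(2) ≤ … ≤ m(e))] -/
theorem exists_point_bIdeal_eq_famIdeal_shift_exponent_of_pBasis (hb : PIndep p 1 b)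
    (htop : IntermediateField.adjoin (frobPow k p 1) (Set.range b) = ⊤) (𝔭 : Ideal (MvPolynomial (Fin (n + 1)) k)) [𝔭.IsPrime]
    (hP : IsPoint k 𝔭) (m : ℕ) :
    ∃ 𝔭' : Ideal (MvPolynomial (Fin (n + 1)) k), IsPoint k 𝔭' ∧
      bIdeal k 𝔭' = famIdeal k p (fun j => hirForms k p 𝔭 (j + m)) ∧
      (∀ j, invForms k p 𝔭' j = invForms k p 𝔭 (j + m)) ∧ exponent k p 𝔭' = exponent k p 𝔭 - m ∧
      hsDim k p 𝔭' = hsDim k p 𝔭 := by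
  have hE : ExponentLE k p 𝔭 (max m (exponent k p 𝔭)) := (exponentLE_exponent k p 𝔭).mono (le_max_right _ _)
  obtain ⟨𝔭', hP', hb', hinv, -, hdim⟩ :=
    exists_point_bIdeal_eq_famIdeal_shift_of_pBasis k p hb htop 𝔭 hP (le_max_left m (exponent k p 𝔭)) hE
  exact ⟨𝔭', hP', hb', hinv, exponent_eq_sub_of_invForms_shift k p 𝔭 hinv, hdim⟩

/-- **LEMMA 2.7 FOR EVERY SHIFT `m`, WITH THE EXACT EXPONENT, for every field of finite `p`-degree.**  AI-written; *AI review is weaker than expert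
review*; not a resolution theorem. [cite: Mizutani1973HironakaGroupSchemes, Lemma 2.7 and Remark 2.10] -/
theorem exists_point_bIdeal_eq_famIdeal_shift_exponent [FiniteDimensional (frobPow k p 1) k]
    (𝔭 : Ideal (MvPolynomial (Fin (n + 1)) k)) [𝔭.IsPrime] (hP : IsPoint k 𝔭) (m : ℕ) :
    ∃ 𝔭' : Ideal (MvPolynomial (Fin (n + 1)) k), IsPoint k 𝔭' ∧
      bIdeal k 𝔭' = famIdeal k p (fun j => hirForms k p 𝔭 (j + m)) ∧
      (∀ j, invForms k p 𝔭' j = invForms k p 𝔭 (j + m)) ∧ exponent k p 𝔭' = exponent k p 𝔭 - m ∧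
      hsDim k p 𝔭' = hsDim k p 𝔭 := by
  obtain ⟨_, _, hb, htop⟩ := exists_pBasis_of_finiteDimensional k p
  exact exists_point_bIdeal_eq_famIdeal_shift_exponent_of_pBasis k p hb htop 𝔭 hP m

/-- `k = F(u_1, …, u_s)` (`F` with `c^p = c`, i.e. `𝔽_p` up to universe) has finite `p`-degree: `[k : k^p] = p^s` (`finrank_ratField`), so all of the
above applies to Mizutani's ground fields of Example 2.1 / Remark 2.10. [cite: Mizutani1973HironakaGroupSchemes, Example 2.1] -/
theorem finiteDimensional_frobPow_one_ratField (F : Type u) [Field F] [CharP F p] (s : ℕ) (hF : ∀ c : F, c ^ p = c) :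
    FiniteDimensional (frobPow (RatField F s) p 1) (RatField F s) :=
  Module.finite_of_finrank_pos (by
    rw [finrank_ratField (p := p) (s := s) hF le_rfl]
    exact pow_pos (pow_pos hp.out.pos 1) s)

end Exponent

end Summit.ResolutionOfSingularities.KangarooAtlas.Mizutani

end
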